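import Summits.BirchSwinnertonDyer.BirchSwinnertonDyer.Theorems.ResidualThetaTransportAtTwoResidualSignedLambdaLowerCMAtTwoFourTermDuality
import Summits.BirchSwinnertonDyer.BirchSwinnertonDyer.Theorems.ResidualThetaTransportAtTwoResidualSignedLambdaLowerCMAtTwoImprimitiveDuality
import HarnessLib

/-!
# Sketch (stub-ideation k1·g8, `stub_cmLambdaLower`) — the CORANK ROAD: the weakest sufficient
# Poitou–Tate input of the 22608 `_of` is ONE pairing-free corank inequality

HONEST FRAMING. THEOREMS ONLY (pure commutative algebra over a commutative ring `A` with fraction field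
`K`, λ-currency `dim_K (K ⊗_A ·)`); no `sorry`, no definition of an arithmetic object, no named fact.
Nothing here proves `stub_cmLambdaLower`, RSL_g (stmt-BirchSwinnertonDyer-22608) or (R≥)ᵖ (stmt-26074);
BSD is NOT proved by any of this.

WHAT IS PROVED (names below, namespace `…Cruxes.ResidualThetaCountLowerPureAtTwo.StubIdeasK1G8`).
§1 For ANY `A`-linear `𝒸 : H → L` and `Z ≤ H` the sequence `H/Z —(𝒸 mod Z)→ L/𝒸(Z) → L/𝒸(H) → 0` is exact
   FOR FREE (`exact_modZ_toCoker`, no duality, no injectivity), hence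
   `λ(L/𝒸(Z)) ≤ λ(H/Z) + λ(L/𝒸(H))` (`finrank_baseChange_quot_map_le`), with EQUALITY when `𝒸` is injective
   (`finrank_baseChange_quot_map_eq`).
§2 THE CORANK-ROAD `_of` ALGEBRA (`le_finrank_characterModule_of_corankRoad`): from
   `hi : d + e ≤ λ(L/𝒸(Z))` (HOLD (i_D) read through `L := Λ_𝒪`, `𝒸 := Col⁺ ∘ loc₂`),
   `hii : λ(H/Z) ≤ λ(Fine⋆) + e` (HOLD (ii_D′), STUB-PLAN rev 9 §0 item 3 / 3.3‴ item 3) and the ONE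
   pairing-free Poitou–Tate number `hPT : Σ + λ(L/𝒸(H)) ≤ λ((Sel ⧸ Fine)⋆)` conclude `d + Σ ≤ λ(Sel⋆)`.
   No `pair`, no `P`, no `locd` into a local carrier, no (EH_Z)/(ORTH)/(DH), no injectivity of `𝒸` (K0) is a
   hypothesis of this lemma.
§3 THE SHARP FORM OF N5 (`finrank_quot_add_le_of_duality`): the landed interface p664041's hypotheses
   (EH_Z), (ORTH), (DH) give the four-term inequality `λ(P/locd Z) + λ(Sel₀⋆) ≤ λ(Sel⋆) + λ(H/Z)` (both
   `…_of_duality` and `…_decorated` are arithmetic corollaries), and at `Z := ⊤` the zeta-free budget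
   `λ(P/locd H) + λ(Sel₀⋆) ≤ λ(Sel⋆)` (`finrank_quot_range_add_le_of_duality`).
§4 (θ″) the product quotient AT THE RANGE (`finrank_baseChange_prod_quot_range_eq`): for injective `𝒸`,
   `λ((L × PS)/(𝒸, locS)(H)) = λ(PS) + λ(L/𝒸(H))`; with §3 this shows that STUB-PLAN rev 9's one-pair supply
   (S1⊕ + S2 + S4rel + S4π) discharges §2's `hPT` (`corankBudget_of_onePair`) — the corank road is WEAKER
   than (implied by) the element road, never stronger.
§5 (`corankBudget_of_split`) the budget is additive along `Fine ≤ Prim ≤ Sel`: the two-pair road (F0)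
   discharges the same `hPT` — the `_of` of §2 is ROAD-AGNOSTIC.

References: [Kobayashi2003, Thm. 7.3 ((7.17)–(7.21))] (four-term sequence), [Greenberg1989, §4–5 (pp. 121–125)]
(global duality ⇒ corank of the cokernel of localisation), [GreenbergVatsal2000, Prop. 2.1, Cor. 2.3],
[MilneADT2006, I Thm. 4.10], [Washington1997, §13.2].
-/

set_option autoImplicit false
-- sketch namespace under the crux dir convention
set_option linter.dupNamespace false

noncomputable section

open scoped TensorProduct Classical

namespace Summit.BirchSwinnertonDyer.BirchSwinnertonDyer.Cruxes.ResidualThetaCountLowerPureAtTwo.StubIdeasK1G8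

open Summit.BirchSwinnertonDyer.BirchSwinnertonDyer.Theorems
open Summit.BirchSwinnertonDyer.BirchSwinnertonDyer.Theorems.CharIdealLambda

universe u v w

/-! ## §1 The free cokernel chain `H/Z → L/𝒸(Z) → L/𝒸(H) → 0` -/

section CokernelChain

variable {A : Type u} [CommRing A] (K : Type w) [Field K] [Algebra A K] [IsFractionRing A K]
  {H : Type v} [AddCommGroup H] [Module A H] {L : Type v} [AddCommGroup L] [Module A L]
  (𝒸 : H →ₗ[A] L) (Z : Submodule A H)

omit [AddCommGroup H] [Module A H] in
theorem map_le_comap_range_id {H' : Type v} [AddCommGroup H'] [Module A H'] (𝒸' : H' →ₗ[A] L)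
    (Z' : Submodule A H') :
    Z'.map 𝒸' ≤ (LinearMap.range 𝒸').comap (LinearMap.id : L →ₗ[A] L) := fun y hy ↦ by
  obtain ⟨x, -, rfl⟩ := Submodule.mem_map.mp hy
  exact Submodule.mem_comap.mpr (LinearMap.mem_range_self 𝒸' x)

/-- `𝒸 mod Z : H/Z → L/𝒸(Z)` (the landed interface's `f`, with `P := L`). [folklore] -/
def modZ : (H ⧸ Z) →ₗ[A] (L ⧸ Z.map 𝒸) := Z.mapQ (Z.map 𝒸) 𝒸 (le_comap_map_locd Z 𝒸)

/-- The projection `L/𝒸(Z) → L/𝒸(H)`. [folklore] -/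
def toCoker : (L ⧸ Z.map 𝒸) →ₗ[A] (L ⧸ LinearMap.range 𝒸) :=
  (Z.map 𝒸).mapQ (LinearMap.range 𝒸) LinearMap.id (map_le_comap_range_id 𝒸 Z)

@[simp] theorem modZ_mk (x : H) : modZ 𝒸 Z (Submodule.Quotient.mk x) = Submodule.Quotient.mk (𝒸 x) := rfl

@[simp] theorem toCoker_mk (y : L) : toCoker 𝒸 Z (Submodule.Quotient.mk y) = Submodule.Quotient.mk y := rfl

/-- `L/𝒸(Z) → L/𝒸(H)` is onto. [folklore] -/
theorem toCoker_surjective : Function.Surjective (toCoker 𝒸 Z) := by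
  intro q
  induction q using Submodule.Quotient.induction_on with
  | H y => exact ⟨Submodule.Quotient.mk y, rfl⟩

/-- **Exactness at `L/𝒸(Z)` is FREE**: `ker (L/𝒸(Z) → L/𝒸(H)) = im (H/Z → L/𝒸(Z))` — no duality, no
injectivity, no zeta element. (Contrast: in N5 the middle exactness `ker g ≤ range f` IS the deep half (DH).)
[folklore] -/
theorem exact_modZ_toCoker : Function.Exact (modZ 𝒸 Z) (toCoker 𝒸 Z) := by
  rw [LinearMap.exact_iff]
  apply le_antisymm
  · intro q hq
    induction q using Submodule.Quotient.induction_on with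
    | H y =>
      rw [LinearMap.mem_ker, toCoker_mk, Submodule.Quotient.mk_eq_zero, LinearMap.mem_range] at hq
      obtain ⟨x, rfl⟩ := hq
      exact ⟨Submodule.Quotient.mk x, rfl⟩
  · rintro _ ⟨q, rfl⟩
    induction q using Submodule.Quotient.induction_on with
    | H x =>
      rw [LinearMap.mem_ker, modZ_mk, toCoker_mk, Submodule.Quotient.mk_eq_zero]
      exact LinearMap.mem_range_self 𝒸 x

/-- `𝒸 mod Z` is injective when `𝒸` is (then `𝒸⁻¹(𝒸 Z) = Z`). [folklore] -/
theorem modZ_injective (hinj : Function.Injective 𝒸) : Function.Injective (modZ 𝒸 Z) := by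
  rw [← LinearMap.ker_eq_bot, eq_bot_iff]
  intro q hq
  induction q using Submodule.Quotient.induction_on with
  | H x =>
    rw [LinearMap.mem_ker, modZ_mk, Submodule.Quotient.mk_eq_zero] at hq
    obtain ⟨y, hy, hyx⟩ := Submodule.mem_map.mp hq
    rw [Submodule.mem_bot, Submodule.Quotient.mk_eq_zero]
    exact hinj hyx ▸ hy

omit [IsFractionRing A K] in
/-- `K ⊗ (L/𝒸(H))` is finite-dimensional as soon as `K ⊗ (L/𝒸(Z))` is (a quotient). [folklore] -/
theorem finite_baseChange_quot_range [Module.Finite K (K ⊗[A] (L ⧸ Z.map 𝒸))] :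
    Module.Finite K (K ⊗[A] (L ⧸ LinearMap.range 𝒸)) := by
  refine Module.Finite.of_surjective ((toCoker 𝒸 Z).baseChange K) ?_
  rw [LinearMap.baseChange_eq_ltensor]
  exact LinearMap.lTensor_surjective K (toCoker_surjective 𝒸 Z)

/-- **`λ(L/𝒸(Z)) ≤ λ(H/Z) + λ(L/𝒸(H))`** — rank–nullity for `L/𝒸(Z) ↠ L/𝒸(H)` after the flat base change
`K ⊗_A ·`, the kernel being the image of `K ⊗ (H/Z)` by the free exactness. NO injectivity of `𝒸`.
[cite: Washington1997, §13.2] -/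
theorem finrank_baseChange_quot_map_le [Module.Finite K (K ⊗[A] (H ⧸ Z))]
    [Module.Finite K (K ⊗[A] (L ⧸ Z.map 𝒸))] :
    Module.finrank K (K ⊗[A] (L ⧸ Z.map 𝒸)) ≤
      Module.finrank K (K ⊗[A] (H ⧸ Z)) + Module.finrank K (K ⊗[A] (L ⧸ LinearMap.range 𝒸)) := by
  haveI : Module.Flat A K := IsLocalization.flat K (nonZeroDivisors A)
  haveI := finite_baseChange_quot_range K 𝒸 Z
  set f' := (modZ 𝒸 Z).baseChange K with hf'
  set g' := (toCoker 𝒸 Z).baseChange K with hg'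
  have hfg' : Function.Exact f' g' := by
    rw [hf', hg', LinearMap.baseChange_eq_ltensor, LinearMap.baseChange_eq_ltensor]
    exact Module.Flat.lTensor_exact K (exact_modZ_toCoker 𝒸 Z)
  have hg's : Function.Surjective g' := by
    rw [hg', LinearMap.baseChange_eq_ltensor]
    exact LinearMap.lTensor_surjective K (toCoker_surjective 𝒸 Z)
  have h1 := g'.finrank_range_add_finrank_ker
  have h2 : Module.finrank K (LinearMap.range g') = Module.finrank K (K ⊗[A] (L ⧸ LinearMap.range 𝒸)) := by
    rw [LinearMap.range_eq_top.mpr hg's, finrank_top]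
  have h3 : Module.finrank K (LinearMap.ker g') ≤ Module.finrank K (K ⊗[A] (H ⧸ Z)) := by
    rw [hfg'.linearMap_ker_eq]; exact f'.finrank_range_le
  omega

/-- **`λ(L/𝒸(Z)) = λ(H/Z) + λ(L/𝒸(H))` when `𝒸` is injective** (the K0 world: `𝐇¹` torsion-free of rank one,
`Col⁺(loc₂ z) ≠ 0`): then `K ⊗ (H/Z)` is automatically finite-dimensional too. [cite: Washington1997, §13.2] -/
theorem finrank_baseChange_quot_map_eq (hinj : Function.Injective 𝒸)
    [Module.Finite K (K ⊗[A] (L ⧸ Z.map 𝒸))] :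
    Module.finrank K (K ⊗[A] (L ⧸ Z.map 𝒸)) =
      Module.finrank K (K ⊗[A] (H ⧸ Z)) + Module.finrank K (K ⊗[A] (L ⧸ LinearMap.range 𝒸)) :=
  LambdaLowerBoundO.finrank_baseChange_eq_of_exact_three K (modZ 𝒸 Z) (toCoker 𝒸 Z)
    (modZ_injective 𝒸 Z hinj) (exact_modZ_toCoker 𝒸 Z) (toCoker_surjective 𝒸 Z)

omit [IsFractionRing A K] in
/-- **The Coleman defect `δ = λ(L/𝒸(H))` is blind to the pin's ambiguity**: post-composing `𝒸` with ANY
`A`-linear automorphism / isomorphism `e : L ≃ L'` (a unit of `Λ_𝒪`, a change of Θ-coordinates, k1-g7's twist)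
leaves `λ(L/𝒸(H))` unchanged. So S2′ need pin `col` only up to `Λ_𝒪`-automorphism as far as the corank road's
PT number is concerned (the VALUE pin is the HOLD's business, (i_D)). [folklore] -/
theorem finrank_baseChange_quot_range_comp_equiv {L' : Type v} [AddCommGroup L'] [Module A L'] (e : L ≃ₗ[A] L') :
    Module.finrank K (K ⊗[A] (L' ⧸ LinearMap.range ((e : L →ₗ[A] L') ∘ₗ 𝒸))) =
      Module.finrank K (K ⊗[A] (L ⧸ LinearMap.range 𝒸)) := by
  have he : (LinearMap.range 𝒸).map (e : L →ₗ[A] L') = LinearMap.range ((e : L →ₗ[A] L') ∘ₗ 𝒸) :=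
    (LinearMap.range_comp _ _).symm
  exact ((Submodule.Quotient.equiv _ _ e he).baseChange A K _ _).finrank_eq.symm

end CokernelChain

/-! ## §2 The corank-road `_of` algebra (pairing-free, K0-free) -/

section CorankRoad

variable {A : Type u} [CommRing A] (K : Type w) [Field K] [Algebra A K] [IsFractionRing A K]
  {H : Type v} [AddCommGroup H] [Module A H] {L : Type v} [AddCommGroup L] [Module A L]
  (𝒸 : H →ₗ[A] L) (Z : Submodule A H)

/-- **Budget form** (flank and target are arbitrary modules `X₀`, `X`): `hi : d + e ≤ λ(L/𝒸(Z))`,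
`hii : λ(H/Z) ≤ λ(X₀) + e`, `hPT : Σ + λ(L/𝒸(H)) + λ(X₀) ≤ λ(X)` ⟹ `d + Σ ≤ λ(X)`.
[cite: Kobayashi2003, Thm. 7.3 ((7.21))] [cite: Washington1997, §13.2] -/
theorem add_le_of_corankBudget {X₀ X : Type v} [AddCommGroup X₀] [Module A X₀] [AddCommGroup X] [Module A X]
    [Module.Finite K (K ⊗[A] (H ⧸ Z))] [Module.Finite K (K ⊗[A] (L ⧸ Z.map 𝒸))] {d e s : ℕ}
    (hi : d + e ≤ Module.finrank K (K ⊗[A] (L ⧸ Z.map 𝒸)))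
    (hii : Module.finrank K (K ⊗[A] (H ⧸ Z)) ≤ Module.finrank K (K ⊗[A] X₀) + e)
    (hPT : s + Module.finrank K (K ⊗[A] (L ⧸ LinearMap.range 𝒸)) + Module.finrank K (K ⊗[A] X₀) ≤
      Module.finrank K (K ⊗[A] X)) :
    d + s ≤ Module.finrank K (K ⊗[A] X) := by
  have := finrank_baseChange_quot_map_le K 𝒸 Z
  omega

/-- **THE CORANK-ROAD `_of`**: for THE Selmer module `Sel` (= `Sg`) and its fine submodule `Fine`:
`hi` (HOLD (i_D) through `L := Λ_𝒪`, `𝒸 := Col⁺ ∘ loc₂`), `hii` (HOLD (ii_D′) in fine-Selmer currency) and the ONE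
pairing-free Poitou–Tate number `hPT : Σ + λ(Λ_𝒪/𝒸(𝐇¹)) ≤ λ((Sel/Fine)⋆)` give `d + Σ ≤ λ(Sel⋆)`.
No `pair`, no (EH)/(ORTH)/(DH), no injectivity of `𝒸`. [cite: Kobayashi2003, Thm. 7.3 ((7.17)–(7.21))]
[cite: Greenberg1989, §5 (pp. 123–125)] [cite: Washington1997, §13.2] -/
theorem le_finrank_characterModule_of_corankRoad {Sel : Type v} [AddCommGroup Sel] [Module A Sel]
    (Fine : Submodule A Sel)
    [Module.Finite K (K ⊗[A] (H ⧸ Z))] [Module.Finite K (K ⊗[A] (L ⧸ Z.map 𝒸))]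
    [Module.Finite K (K ⊗[A] CharacterModule Sel)] {d e s : ℕ}
    (hi : d + e ≤ Module.finrank K (K ⊗[A] (L ⧸ Z.map 𝒸)))
    (hii : Module.finrank K (K ⊗[A] (H ⧸ Z)) ≤ Module.finrank K (K ⊗[A] CharacterModule Fine) + e)
    (hPT : s + Module.finrank K (K ⊗[A] (L ⧸ LinearMap.range 𝒸)) ≤
      Module.finrank K (K ⊗[A] CharacterModule (Sel ⧸ Fine))) :
    d + s ≤ Module.finrank K (K ⊗[A] CharacterModule Sel) := by
  have h1 := finrank_baseChange_quot_map_le K 𝒸 Z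
  have h2 := finrank_baseChange_characterModule_eq_add_quotient K Fine
  omega

/-- **Road-agnostic budget** (§5): if the primitive 2-block `δ + λ(Fine⋆) ≤ λ(Prim⋆)` and the `S₀`-block
`Σ + λ(Prim⋆) ≤ λ(Sel⋆)` are supplied separately (two-pair road F0 / Greenberg–Vatsal), the same `hPT`-budget
`Σ + δ + λ(Fine⋆) ≤ λ(Sel⋆)` results. [cite: GreenbergVatsal2000, Prop. 2.1, Cor. 2.3] -/
theorem corankBudget_of_split {δ s f p t : ℕ} (h₂ : δ + f ≤ p) (hS : s + p ≤ t) : s + δ + f ≤ t := by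
  omega

/-- The quotient currency and the budget currency agree: `Σ + δ ≤ λ((Sel/Fine)⋆)` iff
`Σ + δ + λ(Fine⋆) ≤ λ(Sel⋆)` (Pontryagin additivity, `ℚ/ℤ` injective). [cite: Washington1997, §13.2] -/
theorem budget_iff_quotient {Sel : Type v} [AddCommGroup Sel] [Module A Sel] (Fine : Submodule A Sel)
    [Module.Finite K (K ⊗[A] CharacterModule Sel)] {n : ℕ} :
    n ≤ Module.finrank K (K ⊗[A] CharacterModule (Sel ⧸ Fine)) ↔
      n + Module.finrank K (K ⊗[A] CharacterModule Fine) ≤ Module.finrank K (K ⊗[A] CharacterModule Sel) := by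
  have h2 := finrank_baseChange_characterModule_eq_add_quotient K Fine
  omega

end CorankRoad

/-! ## §3 The SHARP form of N5 and its zeta-free specialisation `Z := ⊤` -/

section SharpDuality

variable {A : Type u} [CommRing A] (K : Type w) [Field K] [Algebra A K] [IsFractionRing A K]
  {Sel : Type v} [AddCommGroup Sel] [Module A Sel]
  {P : Type v} [AddCommGroup P] [Module A P]
  {H : Type v} [AddCommGroup H] [Module A H]
  (pair : P →ₗ[A] CharacterModule Sel) (locd : H →ₗ[A] P) (Z : Submodule A H) (Sel₀ : Submodule A Sel)

/-- **SHARP N5**: (EH_Z), (ORTH), (DH) ⟹ `λ(P/locd Z) + λ(Sel₀⋆) ≤ λ(Sel⋆) + λ(H/Z)` (the landed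
`…_of_duality` / `…_decorated` are its arithmetic corollaries; under full Poitou–Tate it is an equality,
STUB-PLAN rev 9 S23). Proof = p664041's, keeping all four numbers. [cite: Kobayashi2003, Thm. 7.3 ((7.21))]
[cite: MilneADT2006, Ch. I, Thm. 4.10] -/
theorem finrank_quot_add_le_of_duality
    (hEH : ∀ z ∈ Z, pair (locd z) = 0) (horth : ∀ s ∈ Sel₀, ∀ z : P, pair z s = 0)
    (hDH : ∀ z : P, pair z = 0 → ∃ a : A, a ≠ 0 ∧ ∃ x : H, a • z = locd x)
    [Module.Finite K (K ⊗[A] (H ⧸ Z))] [Module.Finite K (K ⊗[A] (P ⧸ Z.map locd))]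
    [Module.Finite K (K ⊗[A] CharacterModule Sel)] :
    Module.finrank K (K ⊗[A] (P ⧸ Z.map locd)) + Module.finrank K (K ⊗[A] CharacterModule Sel₀) ≤
      Module.finrank K (K ⊗[A] CharacterModule Sel) + Module.finrank K (K ⊗[A] (H ⧸ Z)) := by
  haveI : Module.Flat A K := IsLocalization.flat K (nonZeroDivisors A)
  have hle := map_le_ker_of_pair_locd pair locd Z hEH
  set f : (H ⧸ Z) →ₗ[A] (P ⧸ Z.map locd) := Z.mapQ (Z.map locd) locd (le_comap_map_locd Z locd) with hf
  set g : (P ⧸ Z.map locd) →ₗ[A] CharacterModule Sel := (Z.map locd).liftQ pair hle with hg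
  set h : CharacterModule Sel →ₗ[A] CharacterModule Sel₀ := CharacterModule.dual Sel₀.subtype with hh
  have hker : ∀ q ∈ LinearMap.ker g, ∃ a : A, a ≠ 0 ∧ a • q ∈ LinearMap.range f :=
    fun q hq ↦ exists_smul_mem_range_mapQ_of_mem_ker_liftQ pair locd Z hle hDH q hq
  have hcomp : LinearMap.range g ≤ LinearMap.ker h := range_liftQ_le_ker_dual_subtype pair locd Z hle Sel₀ horth
  have hhsurj : Function.Surjective h := dual_subtype_surjective Sel₀
  set f' := f.baseChange K with hf'
  set g' := g.baseChange K with hg'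
  set h' := h.baseChange K with hh'
  have hh'surj : Function.Surjective h' := by
    rw [hh', LinearMap.baseChange_eq_ltensor]
    exact LinearMap.lTensor_surjective K hhsurj
  haveI : Module.Finite K (K ⊗[A] CharacterModule Sel₀) := Module.Finite.of_surjective h' hh'surj
  have hker' : LinearMap.ker g' ≤ LinearMap.range f' :=
    ker_baseChange_le_range_baseChange_of_smul_mem_range K f g hker
  have hcomp' : LinearMap.range g' ≤ LinearMap.ker h' := by
    rintro _ ⟨y, rfl⟩
    have hy : (g.lTensor K) y ∈ LinearMap.ker (h.lTensor K) := range_lTensor_le_ker_lTensor K g h hcomp ⟨y, rfl⟩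
    rw [LinearMap.mem_ker] at hy ⊢
    rw [hh', hg', LinearMap.baseChange_eq_ltensor, LinearMap.baseChange_eq_ltensor]
    exact hy
  have h1 := g'.finrank_range_add_finrank_ker
  have h2 := h'.finrank_range_add_finrank_ker
  have h3 : Module.finrank K (LinearMap.ker g') ≤ Module.finrank K (K ⊗[A] (H ⧸ Z)) :=
    (Submodule.finrank_mono hker').trans f'.finrank_range_le
  have h4 : Module.finrank K (LinearMap.range g') ≤ Module.finrank K (LinearMap.ker h') :=
    Submodule.finrank_mono hcomp'
  have h5 : Module.finrank K (LinearMap.range h') = Module.finrank K (K ⊗[A] CharacterModule Sel₀) := by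
    rw [LinearMap.range_eq_top.mpr hh'surj, finrank_top]
  omega

omit [IsFractionRing A K] [Module A Sel] [AddCommGroup P] [Module A P] in
/-- `K ⊗ (H/H) = 0`. [folklore] -/
theorem subsingleton_baseChange_quot_top : Subsingleton (K ⊗[A] (H ⧸ (⊤ : Submodule A H))) := by
  haveI : Subsingleton (H ⧸ (⊤ : Submodule A H)) := ⟨fun a b ↦ by
    induction a using Submodule.Quotient.induction_on with
    | H x =>
      induction b using Submodule.Quotient.induction_on with
      | H y => exact (Submodule.Quotient.eq ⊤).mpr Submodule.mem_top⟩
  refine subsingleton_of_forall_eq 0 fun x ↦ ?_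
  induction x using TensorProduct.induction_on with
  | zero => rfl
  | tmul k v => rw [Subsingleton.elim v 0, TensorProduct.tmul_zero]
  | add a b ha hb => rw [ha, hb, add_zero]

/-- **Zeta-free budget from the element road** (`Z := ⊤`): (EH) for every global class, (ORTH), (DH) ⟹
`λ(P/locd H) + λ(Sel₀⋆) ≤ λ(Sel⋆)`. This is how STUB-PLAN rev 9's one-pair supply (or any (DH)-supply)
discharges the corank road's `hPT`. [cite: Kobayashi2003, Thm. 7.3 ((7.21))] [cite: MilneADT2006, Ch. I, Thm. 4.10] -/
theorem finrank_quot_range_add_le_of_duality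
    (hEH : ∀ x : H, pair (locd x) = 0) (horth : ∀ s ∈ Sel₀, ∀ z : P, pair z s = 0)
    (hDH : ∀ z : P, pair z = 0 → ∃ a : A, a ≠ 0 ∧ ∃ x : H, a • z = locd x)
    [Module.Finite K (K ⊗[A] (P ⧸ LinearMap.range locd))] [Module.Finite K (K ⊗[A] CharacterModule Sel)] :
    Module.finrank K (K ⊗[A] (P ⧸ LinearMap.range locd)) + Module.finrank K (K ⊗[A] CharacterModule Sel₀) ≤
      Module.finrank K (K ⊗[A] CharacterModule Sel) := by
  haveI := subsingleton_baseChange_quot_top K (A := A) (H := H)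
  haveI : Module.Finite K (K ⊗[A] (H ⧸ (⊤ : Submodule A H))) :=
    Module.Finite.of_surjective (0 : K →ₗ[K] K ⊗[A] (H ⧸ (⊤ : Submodule A H))) fun x ↦ ⟨0, Subsingleton.elim _ _⟩
  haveI : Module.Finite K (K ⊗[A] (P ⧸ (⊤ : Submodule A H).map locd)) := by
    rw [Submodule.map_top]; infer_instance
  have h0 : Module.finrank K (K ⊗[A] (H ⧸ (⊤ : Submodule A H))) = 0 := Module.finrank_zero_of_subsingleton
  have h := finrank_quot_add_le_of_duality K pair locd ⊤ Sel₀ (fun z _ ↦ hEH z) horth hDH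
  rw [Submodule.map_top] at h
  omega

end SharpDuality

/-! ## §4 (θ″) The product quotient at the range, and «one-pair supply ⟹ corank budget» -/

section ProductQuotient

variable {A : Type u} [CommRing A] (K : Type w) [Field K] [Algebra A K] [IsFractionRing A K]
  {H : Type v} [AddCommGroup H] [Module A H] {L : Type v} [AddCommGroup L] [Module A L]
  {PS : Type v} [AddCommGroup PS] [Module A PS]
  (𝒸 : H →ₗ[A] L) (locS : H →ₗ[A] PS)

/-- `PS → (L × PS)/(𝒸, locS)(H)`, `p ↦ [(0, p)]`. [folklore] -/
def inS : PS →ₗ[A] ((L × PS) ⧸ LinearMap.range (𝒸.prod locS)) :=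
  (LinearMap.range (𝒸.prod locS)).mkQ ∘ₗ LinearMap.inr A L PS

omit [AddCommGroup H] [Module A H] in
theorem range_prod_le_comap_fst {H' : Type v} [AddCommGroup H'] [Module A H'] (𝒸' : H' →ₗ[A] L)
    (locS' : H' →ₗ[A] PS) :
    LinearMap.range (𝒸'.prod locS') ≤ (LinearMap.range 𝒸').comap (LinearMap.fst A L PS) := by
  rintro _ ⟨x, rfl⟩
  exact Submodule.mem_comap.mpr (LinearMap.mem_range_self 𝒸' x)

/-- `(L × PS)/(𝒸, locS)(H) → L/𝒸(H)`, first projection. [folklore] -/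
def toFst : ((L × PS) ⧸ LinearMap.range (𝒸.prod locS)) →ₗ[A] (L ⧸ LinearMap.range 𝒸) :=
  (LinearMap.range (𝒸.prod locS)).mapQ (LinearMap.range 𝒸) (LinearMap.fst A L PS) (range_prod_le_comap_fst 𝒸 locS)

@[simp] theorem inS_apply (p : PS) : inS 𝒸 locS p = Submodule.Quotient.mk ((0 : L), p) := rfl

@[simp] theorem toFst_mk (t : L × PS) : toFst 𝒸 locS (Submodule.Quotient.mk t) = Submodule.Quotient.mk t.1 := rfl

theorem toFst_surjective : Function.Surjective (toFst 𝒸 locS) := by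
  intro q
  induction q using Submodule.Quotient.induction_on with
  | H y => exact ⟨Submodule.Quotient.mk (y, 0), rfl⟩

/-- Exactness at the product quotient: `[(l, p)] ↦ 0` iff `l = 𝒸 x`, and then `[(l, p)] = [(0, p - locS x)]`. [folklore] -/
theorem exact_inS_toFst : Function.Exact (inS 𝒸 locS) (toFst 𝒸 locS) := by
  rw [LinearMap.exact_iff]
  apply le_antisymm
  · intro q hq
    induction q using Submodule.Quotient.induction_on with
    | H t =>
      rw [LinearMap.mem_ker, toFst_mk, Submodule.Quotient.mk_eq_zero] at hq
      obtain ⟨x, hx⟩ := LinearMap.mem_range.mp hq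
      refine ⟨t.2 - locS x, ?_⟩
      rw [inS_apply, Submodule.Quotient.eq]
      refine ⟨-x, Prod.ext ?_ ?_⟩
      · have h1 : ((𝒸.prod locS) (-x)).1 = -𝒸 x := map_neg 𝒸 x
        rw [h1, Prod.fst_sub, hx, zero_sub]
      · have h2 : ((𝒸.prod locS) (-x)).2 = -locS x := map_neg locS x
        rw [h2, Prod.snd_sub, sub_sub_cancel_left]
  · rintro _ ⟨p, rfl⟩
    rw [LinearMap.mem_ker, inS_apply, toFst_mk]
    exact Submodule.Quotient.mk_zero _

/-- `inS` is injective when `𝒸` is (then `(0, p) = (𝒸 x, locS x)` forces `x = 0`). [folklore] -/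
theorem inS_injective (hinj : Function.Injective 𝒸) : Function.Injective (inS 𝒸 locS) := by
  rw [← LinearMap.ker_eq_bot, eq_bot_iff]
  intro p hp
  rw [LinearMap.mem_ker, inS_apply, Submodule.Quotient.mk_eq_zero] at hp
  obtain ⟨x, hx⟩ := LinearMap.mem_range.mp hp
  have h1 : 𝒸 x = 0 := congrArg Prod.fst hx
  have h2 : locS x = p := congrArg Prod.snd hx
  have hx0 : x = 0 := hinj (by rw [h1, map_zero])
  rw [Submodule.mem_bot, ← h2, hx0, map_zero]

/-- **(θ″) product quotient at the range**: for injective `𝒸`,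
`λ((L × PS)/(𝒸, locS)(H)) = λ(PS) + λ(L/𝒸(H))`. (Twin at `Z := ⊤` of the (θ′) count of STUB-PLAN rev 8/9.)
[cite: Washington1997, §13.2] -/
theorem finrank_baseChange_prod_quot_range_eq (hinj : Function.Injective 𝒸)
    [Module.Finite K (K ⊗[A] ((L × PS) ⧸ LinearMap.range (𝒸.prod locS)))] :
    Module.finrank K (K ⊗[A] ((L × PS) ⧸ LinearMap.range (𝒸.prod locS))) =
      Module.finrank K (K ⊗[A] PS) + Module.finrank K (K ⊗[A] (L ⧸ LinearMap.range 𝒸)) :=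
  LambdaLowerBoundO.finrank_baseChange_eq_of_exact_three K (inS 𝒸 locS) (toFst 𝒸 locS)
    (inS_injective 𝒸 locS hinj) (exact_inS_toFst 𝒸 locS) (toFst_surjective 𝒸 locS)

/-- **One-pair supply ⟹ corank budget.** With `P := L × PS`, `locd := (𝒸, locS)`, a pairing `pair : P → Sel⋆` with
(EH) on all of `H`, (ORTH) for `Sel₀`, (DH), `𝒸` injective (K0) and the local count `Σ ≤ λ(PS)` (S1⊕):
`Σ + λ(L/𝒸(H)) + λ(Sel₀⋆) ≤ λ(Sel⋆)` — the hypothesis `hPT` of `le_finrank_characterModule_of_corankRoad`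
(via `budget_iff_quotient`). [cite: Kobayashi2003, Thm. 7.3] [cite: GreenbergVatsal2000, Prop. 2.1] -/
theorem corankBudget_of_onePair {Sel : Type v} [AddCommGroup Sel] [Module A Sel]
    (pair : (L × PS) →ₗ[A] CharacterModule Sel) (Sel₀ : Submodule A Sel)
    (hEH : ∀ x : H, pair ((𝒸.prod locS) x) = 0) (horth : ∀ s ∈ Sel₀, ∀ z : L × PS, pair z s = 0)
    (hDH : ∀ z : L × PS, pair z = 0 → ∃ a : A, a ≠ 0 ∧ ∃ x : H, a • z = (𝒸.prod locS) x)
    (hinj : Function.Injective 𝒸) {s : ℕ} (hs : s ≤ Module.finrank K (K ⊗[A] PS))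
    [Module.Finite K (K ⊗[A] ((L × PS) ⧸ LinearMap.range (𝒸.prod locS)))]
    [Module.Finite K (K ⊗[A] CharacterModule Sel)] :
    s + Module.finrank K (K ⊗[A] (L ⧸ LinearMap.range 𝒸)) + Module.finrank K (K ⊗[A] CharacterModule Sel₀) ≤
      Module.finrank K (K ⊗[A] CharacterModule Sel) := by
  have h1 := finrank_quot_range_add_le_of_duality K pair (𝒸.prod locS) Sel₀ hEH horth hDH
  have h2 := finrank_baseChange_prod_quot_range_eq K 𝒸 locS hinj
  omega

end ProductQuotient

end Summit.BirchSwinnertonDyer.BirchSwinnertonDyer.Cruxes.ResidualThetaCountLowerPureAtTwo.StubIdeasK1G8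

end
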